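import Literature.Topology.FourManifolds.UnorientedDiscTheorem
import Literature.Topology.FourManifolds.OrientedConnectedSumTransportProofs
import HarnessLib

/-!
# Uniqueness of the connected sum with an amphichiral summand, without orientations

Topic `Literature/Topology/FourManifolds`. The tree's relational connected sum
`Literature.Topology.FourManifolds.IsConnectedSum IP IM IN M N P` (`ConnectedSum.lean`) records
no orientations, so in general two connected sums `P`, `P'` of the same `M`, `N` need not be
diffeomorphic (`ℂℙ² # ℂℙ²` versus `ℂℙ² # -ℂℙ²`); the tree proves uniqueness for the ORIENTED
connected sum (`ConnectedSumUniquenessProofs.lean`). This file proves the classical complement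
(Kervaire–Milnor, *Groups of homotopy spheres I*, Ann. of Math. 77 (1963), §2, Lemma 2.1 and the
remark on orientations; Kosinski, *Differential Manifolds* (1993), Ch. VI §1, Thm. (1.1) with
Ch. III Thm. (3.6); Wall, *On simply-connected 4-manifolds*, J. London Math. Soc. 39 (1964), §1 for
`M # (S² × S²)`): **if every two discs of `N` are related by a diffeomorphism of `N` — in
particular if `N` is connected and admits a diffeomorphism reversing a disc ("amphichiral") —
then `M # N` is well defined up to diffeomorphism for every connected `M`, orientable or not,
with or without boundary, and whatever the models.**

* `Literature.Topology.FourManifolds.connectedSumRel_iff_of_apply_disc_eq` — Kervaire–Milnor's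
  gluing relation is invariant under diffeomorphisms `f ∈ Diff(M)`, `g ∈ Diff(N)` carrying the
  discs `(i₁, i₂)` to `(i₁' ∘ ρ, i₂' ∘ ρ)` on the unit ball, `ρ` a linear isometry (the tree's
  `connectedSumRel_symm_apply_iff`, for summands with arbitrary and different models).
* `Literature.Topology.FourManifolds.nonempty_diffeomorph_of_isConnectedSum_of_discs_equivalent`
  — the uniqueness theorem: `M` connected (any model `IM` over the disc space `E`), `N` with
  the property that any two discs `k, k' : E → N` satisfy `g ∘ k = k'` on the unit ball for
  some `g ∈ Diff(N)`; then any two connected sums `P`, `P'` (any models `IP`, `IP'` over `E`)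
  are diffeomorphic. Proof: the unoriented disc theorem in `M`
  (`exists_diffeomorph_apply_disc_eq_or_reflect_of_model`, `UnorientedDiscTheorem.lean`) gives
  `F ∈ Diff(M)` with `F ∘ i₁ = i₁' ∘ ρ` on the unit ball for `ρ = 1` or `ρ = r⁻¹` (`r` a
  reflection); the hypothesis on `N` gives `g` with `g ∘ i₂ = i₂' ∘ ρ`; hence `P` is an open
  gluing of the primed punctured pieces along the primed relation, and open gluings are unique
  (`IsOpenGluing.exists_diffeomorph_comp_eq`).
* `Literature.Topology.FourManifolds.discs_equivalent_of_equivariant_disc` — the hypothesis on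
  `N` holds when `N` is connected, boundaryless, and carries ONE disc `c : E → N` which is
  equivariant for a reflection: `ρ (c y) = c (r y)` for a diffeomorphism `ρ` of `N` and a linear
  isometry `r` of `E` with `det r < 0` (the model vector space `EN` of `N` may differ from `E`;
  a linear isomorphism `Λ : E ≃L EN` is part of the data). Proof: by the
  unoriented disc theorem in `N` every disc `k` satisfies `g ∘ k = c` or `g ∘ k ∘ r = c` on the
  ball; in the second case `ρ ∘ g ∘ k = c`.

The instance `N = S² × S²` (reflection in one factor, product of stereographic discs), which
discharges the named fact
`Literature.Barriers.SmoothPoincare4.nonempty_diffeomorph_of_isConnectedSum_sphereTwoProd`, is in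
`Literature/Barriers/SmoothPoincare4/ExoticContractibleKangStabilisationProofs.lean`.

## References

* M. Kervaire, J. Milnor, *Groups of homotopy spheres I*, Ann. of Math. 77 (1963), §2,
  Lemma 2.1. [KervaireMilnorAnnals1963]
* A. Kosinski, *Differential Manifolds* (1993), Ch. III Thm. (3.6), Ch. VI §1 Thm. (1.1).
  [Kosinski1993]
* C. T. C. Wall, *On simply-connected 4-manifolds*, J. London Math. Soc. 39 (1964). [WallJLMS1964]
* M. W. Hirsch, *Differential Topology*, GTM 33 (1976), Ch. 8 §3, Thm. 3.1. [HirschDT1976]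
-/

open scoped Manifold ContDiff Topology
open Set Module Function Filter OpenPartialHomeomorph Metric

noncomputable section

namespace Literature.Topology.FourManifolds

/-! ### Invariance of Kervaire–Milnor's relation (summands with arbitrary models) -/

section Relation

variable {E : Type*} [NormedAddCommGroup E] [NormedSpace ℝ E]
  {EN : Type*} [NormedAddCommGroup EN] [NormedSpace ℝ EN]
  {HM HN : Type*} [TopologicalSpace HM] [TopologicalSpace HN]
  {IM : ModelWithCorners ℝ E HM} {IN : ModelWithCorners ℝ EN HN}
  {M N : Type*} [TopologicalSpace M] [T2Space M] [ChartedSpace HM M]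
  [TopologicalSpace N] [T2Space N] [ChartedSpace HN N]

/-- **Kervaire–Milnor's connected sum relation is invariant under a simultaneous isometric
reparametrisation of both discs after ambient diffeomorphisms** — version for summands `M`, `N`
with arbitrary (and different) models: if `f (i₁ y) = i₁' (ρ y)` and `g (i₂ y) = i₂' (ρ y)` on
the closed unit ball of the disc space `E` (`ρ` a linear isometry of `E`), then `(f⁻¹ a, g⁻¹ b)`
is related for `(i₁, i₂)` iff `(a, b)` is related for `(i₁', i₂')` (Kervaire–Milnor 1963, §2,
proof of Lemma 2.1; the tree's `connectedSumRel_symm_apply_iff` is the case of `ℝⁿ`-modelled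
summands). [cite: KervaireMilnorAnnals1963, §2, Lemma 2.1 (p. 505)] -/
theorem connectedSumRel_iff_of_apply_disc_eq {i₁ i₁' : E → M} {i₂ i₂' : E → N}
    (f : M ≃ₘ⟮IM, IM⟯ M) (g : N ≃ₘ⟮IN, IN⟯ N) (ρ : E ≃ₗᵢ[ℝ] E)
    (hf : ∀ y : E, ‖y‖ ≤ 1 → f (i₁ y) = i₁' (ρ y))
    (hg : ∀ y : E, ‖y‖ ≤ 1 → g (i₂ y) = i₂' (ρ y))
    (a : ↥(puncture i₁)) (b : ↥(puncture i₂)) (a' : ↥(puncture i₁')) (b' : ↥(puncture i₂'))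
    (ha : (a : M) = f.symm a') (hb : (b : N) = g.symm b') :
    connectedSumRel i₁ i₂ a b ↔ connectedSumRel i₁' i₂' a' b' := by
  have hnorm : ∀ (u : E) (t : ℝ), ‖u‖ = 1 → t ∈ Ioo (0 : ℝ) 1 →
      ‖t • u‖ ≤ 1 ∧ ‖(1 - t) • u‖ ≤ 1 := by
    intro u t hu ht
    constructor
    · rw [norm_smul, Real.norm_of_nonneg ht.1.le, hu, mul_one]; exact ht.2.le
    · rw [norm_smul, Real.norm_of_nonneg (by linarith [ht.2]), hu, mul_one]; linarith [ht.1]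
  constructor
  · rintro ⟨u, t, hu, ht, hau, hbu⟩
    obtain ⟨h1, h2⟩ := hnorm u t hu ht
    refine ⟨ρ u, t, by rw [ρ.norm_map, hu], ht, ?_, ?_⟩
    · have e1 : (a' : M) = f a := by rw [ha, f.apply_symm_apply]
      rw [e1, hau, hf _ h1, map_smul]
    · have e2 : (b' : N) = g b := by rw [hb, g.apply_symm_apply]
      rw [e2, hbu, hg _ h2, map_smul]
  · rintro ⟨u', t, hu', ht, hau, hbu⟩
    set u := ρ.symm u' with hu_def
    have hu : ‖u‖ = 1 := by rw [hu_def, ρ.symm.norm_map, hu']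
    have hru : ρ u = u' := ρ.apply_symm_apply u'
    obtain ⟨h1, h2⟩ := hnorm u t hu ht
    refine ⟨u, t, hu, ht, ?_, ?_⟩
    · rw [ha, hau, ← hru, ← map_smul, ← hf _ h1, f.symm_apply_apply]
    · rw [hb, hbu, ← hru, ← map_smul, ← hg _ h2, g.symm_apply_apply]

end Relation

/-! ### Uniqueness of `M # N` when all discs of `N` are equivalent -/

section Uniqueness

variable {E : Type*} [NormedAddCommGroup E] [NormedSpace ℝ E] [FiniteDimensional ℝ E]
  {EN : Type*} [NormedAddCommGroup EN] [NormedSpace ℝ EN]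
  {HM HN HP HP' : Type*} [TopologicalSpace HM] [TopologicalSpace HN] [TopologicalSpace HP]
  [TopologicalSpace HP']
  {IM : ModelWithCorners ℝ E HM} {IN : ModelWithCorners ℝ EN HN}
  {IP : ModelWithCorners ℝ E HP} {IP' : ModelWithCorners ℝ E HP'}
  {M N P P' : Type*} [TopologicalSpace M] [T2Space M] [ChartedSpace HM M] [IsManifold IM ∞ M]
  [TopologicalSpace N] [T2Space N] [ChartedSpace HN N] [IsManifold IN ∞ N]
  [TopologicalSpace P] [ChartedSpace HP P] [IsManifold IP ∞ P]
  [TopologicalSpace P'] [ChartedSpace HP' P'] [IsManifold IP' ∞ P']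

/-- **The connected sum with a summand all of whose discs are equivalent is well defined up to
diffeomorphism, without orientation conventions** (Kervaire–Milnor, *Groups of homotopy
spheres I* (1963), §2, Lemma 2.1 with the unoriented disc theorem, Kosinski, *Differential
Manifolds* (1993), VI.(1.1) and III.(3.6); the mechanism behind "`X ♯ (S² × S²)` is well
defined", Wall 1964, §1). Let `M` be a connected Hausdorff `C^∞` manifold with an arbitrary
real model `IM` over the finite-dimensional disc space `E ≠ 0`, and `N` a Hausdorff manifold
(model `IN`, possibly over another vector space) in which ANY two discs `k, k' : E → N` are
related by a diffeomorphism, `g (k y) = k' y` for `‖y‖ ≤ 1` (hypothesis `hN`; e.g. `N`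
connected with a reflection-equivariant disc, `discs_equivalent_of_equivariant_disc`). Then any
two connected sums `P`, `P'` of `M` and `N` in the tree's relational sense (for any models `IP`,
`IP'` over `E`) are diffeomorphic. Proof: the unoriented disc theorem in `M`
(`exists_diffeomorph_apply_disc_eq_or_reflect_of_model`, with a reflection `r`) gives
`F ∈ Diff(M)` with `F ∘ i₁ = i₁' ∘ ρ` on the unit ball, `ρ ∈ {1, r⁻¹}`; `hN` applied to
`(i₂, i₂' ∘ ρ)` gives `g ∈ Diff(N)` with `g ∘ i₂ = i₂' ∘ ρ`; so `P` is an open gluing of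
`M ∖ {i₁' 0}`, `N ∖ {i₂' 0}` along Kervaire–Milnor's relation for `(i₁', i₂')`
(`connectedSumRel_iff_of_apply_disc_eq`), as is `P'`, and open gluings of the same data are
diffeomorphic (`IsOpenGluing.exists_diffeomorph_comp_eq`).
[cite: KervaireMilnorAnnals1963, §2, Lemma 2.1 (p. 505)]
[cite: Kosinski1993, Ch. VI §1, Thm (1.1)] -/
theorem nonempty_diffeomorph_of_isConnectedSum_of_discs_equivalent [ConnectedSpace M]
    (hE : finrank ℝ E ≠ 0) (r : E ≃ₗᵢ[ℝ] E)
    (hr : LinearMap.det (r.toLinearEquiv : E →ₗ[ℝ] E) < 0)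
    (hN : ∀ k k' : E → N, Manifold.IsSmoothEmbedding 𝓘(ℝ, E) IN ∞ k →
      Manifold.IsSmoothEmbedding 𝓘(ℝ, E) IN ∞ k' →
        ∃ g : N ≃ₘ⟮IN, IN⟯ N, ∀ y : E, ‖y‖ ≤ 1 → g (k y) = k' y)
    (h : IsConnectedSum IP IM IN M N P) (h' : IsConnectedSum IP' IM IN M N P') :
    Nonempty (P ≃ₘ⟮IP, IP'⟯ P') := by
  obtain ⟨i₁, i₂, hi₁, hi₂, jA, jB, hA, hAo, hB, hBo, hU, hR⟩ := h
  obtain ⟨i₁', i₂', hi₁', hi₂', jA', jB', hA', hAo', hB', hBo', hU', hR'⟩ := h'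
  -- the unoriented disc theorem in `M`, and the matching diffeomorphism of `N`
  obtain ⟨ρ, F, g, hF, hg⟩ : ∃ (ρ : E ≃ₗᵢ[ℝ] E) (F : M ≃ₘ⟮IM, IM⟯ M) (g : N ≃ₘ⟮IN, IN⟯ N),
      (∀ y : E, ‖y‖ ≤ 1 → F (i₁ y) = i₁' (ρ y)) ∧ (∀ y : E, ‖y‖ ≤ 1 → g (i₂ y) = i₂' (ρ y)) := by
    have hr' : LinearMap.det ((r.toContinuousLinearEquiv).toLinearEquiv : E →ₗ[ℝ] E) < 0 := hr
    obtain ⟨F, hF⟩ := exists_diffeomorph_apply_disc_eq_or_reflect_of_model hE hi₁ hi₁'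
      r.toContinuousLinearEquiv hr'
    rcases hF with hF | hF
    · obtain ⟨g, hg⟩ := hN i₂ i₂' hi₂ hi₂'
      exact ⟨LinearIsometryEquiv.refl ℝ E, F, g, fun y hy => by simpa using hF y hy,
        fun y hy => by simpa using hg y hy⟩
    · have hi₂r : Manifold.IsSmoothEmbedding 𝓘(ℝ, E) IN ∞ (i₂' ∘ r.symm) :=
        hi₂'.comp_diffeomorph r.symm.toContinuousLinearEquiv.toDiffeomorph
      obtain ⟨g, hg⟩ := hN i₂ (i₂' ∘ r.symm) hi₂ hi₂r
      refine ⟨r.symm, F, g, fun y hy => ?_, fun y hy => hg y hy⟩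
      have h1 : ‖r.symm y‖ ≤ 1 := by rw [r.symm.norm_map]; exact hy
      have h2 := hF (r.symm y) h1
      rw [show r.toContinuousLinearEquiv (r.symm y) = y from r.apply_symm_apply y] at h2
      exact h2
  -- the centres correspond
  have hF0 : F (i₁ 0) = i₁' 0 := by have := hF 0 (by simp); simpa using this
  have hg0 : g (i₂ 0) = i₂' 0 := by have := hg 0 (by simp); simpa using this
  -- restrictions of `F⁻¹`, `g⁻¹` to the punctured pieces
  obtain ⟨ψA, hψA⟩ := exists_diffeomorph_opens F.symm (puncture i₁') (puncture i₁) (fun x => by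
    simp only [mem_puncture]
    rw [← hF0]
    exact ⟨fun h1 h2 => h1 (by rw [h2, F.symm_apply_apply]), fun h1 h2 => h1 (by
      rw [← F.apply_symm_apply x, h2])⟩)
  obtain ⟨ψB, hψB⟩ := exists_diffeomorph_opens g.symm (puncture i₂') (puncture i₂) (fun x => by
    simp only [mem_puncture]
    rw [← hg0]
    exact ⟨fun h1 h2 => h1 (by rw [h2, g.symm_apply_apply]), fun h1 h2 => h1 (by
      rw [← g.apply_symm_apply x, h2])⟩)
  -- `P` re-read as a gluing of the primed pieces
  set jA'' : ↥(puncture i₁') → P := jA ∘ ψA with hjA''_def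
  set jB'' : ↥(puncture i₂') → P := jB ∘ ψB with hjB''_def
  have hA'' : Manifold.IsSmoothEmbedding IM IP ∞ jA'' := hA.comp_diffeomorph ψA
  have hB'' : Manifold.IsSmoothEmbedding IN IP ∞ jB'' := hB.comp_diffeomorph ψB
  have hrA : range jA'' = range jA := ψA.surjective.range_comp jA
  have hrB : range jB'' = range jB := ψB.surjective.range_comp jB
  have hAo'' : IsOpen (range jA'') := hrA ▸ hAo
  have hBo'' : IsOpen (range jB'') := hrB ▸ hBo
  have hU'' : range jA'' ∪ range jB'' = univ := by rw [hrA, hrB, hU]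
  have hR'' : ∀ a b, jA'' a = jB'' b ↔ connectedSumRel i₁' i₂' a b := fun a b => by
    rw [show jA'' a = jA (ψA a) from rfl, show jB'' b = jB (ψB b) from rfl, hR]
    exact connectedSumRel_iff_of_apply_disc_eq F g ρ hF hg (ψA a) (ψB b) a b (hψA a) (hψB b)
  -- the comparison diffeomorphism
  obtain ⟨Ψ, -, -⟩ := IsOpenGluing.exists_diffeomorph_comp_eq hA'' hAo'' hB'' hBo'' hU'' hR''
    hA' hAo' hB' hBo' hU' hR'
  exact ⟨Ψ⟩

end Uniqueness

/-! ### Discs of an amphichiral summand are equivalent -/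

section Amphichiral

variable {E : Type*} [NormedAddCommGroup E] [NormedSpace ℝ E] [FiniteDimensional ℝ E]
  {EN : Type*} [NormedAddCommGroup EN] [NormedSpace ℝ EN]
  {HN : Type*} [TopologicalSpace HN] {IN : ModelWithCorners ℝ EN HN}
  {N : Type*} [TopologicalSpace N] [T2Space N] [ChartedSpace HN N] [IsManifold IN ∞ N]

omit [T2Space N] in
/-- **A disc reparametrised by a linear isomorphism of parameter spaces is a disc.** If
`k : E → N` is a smooth embedding of the finite-dimensional space `E` into the boundaryless
manifold `N` (model `IN` over `EN`, of the same dimension as `E`) and `Λ : E ≃L E'`, then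
`k ∘ Λ⁻¹ : E' → N` is a smooth embedding: it is a partial diffeomorphism with source `E'`
(`isSmoothEmbedding_of_openPartialHomeomorph`; `k` is open by invariance of domain,
`Manifold.IsSmoothEmbedding.isOpenMap_of_finrank_eq`, and its inverse is smooth on the range,
`contMDiffOn_symm_of_isSmoothEmbedding`). (Lee, *Introduction to Smooth Manifolds* (2013),
Prop. 5.2.) [folklore] -/
theorem isSmoothEmbedding_disc_comp_symm [IN.Boundaryless] [FiniteDimensional ℝ EN]
    {E' : Type*} [NormedAddCommGroup E'] [NormedSpace ℝ E'] {k : E → N}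
    (hk : Manifold.IsSmoothEmbedding 𝓘(ℝ, E) IN ∞ k) (hdim : finrank ℝ E = finrank ℝ EN)
    (Λ : E ≃L[ℝ] E') :
    Manifold.IsSmoothEmbedding 𝓘(ℝ, E') IN ∞ (k ∘ (Λ.symm : E' → E)) := by
  haveI : FiniteDimensional ℝ E' := LinearEquiv.finiteDimensional Λ.toLinearEquiv
  have hemb : Topology.IsOpenEmbedding k :=
    .of_continuous_injective_isOpenMap hk.contMDiff.continuous hk.isEmbedding.injective
      (Manifold.IsSmoothEmbedding.isOpenMap_of_finrank_eq hk hdim)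
  set Φ₀ := hemb.toOpenPartialHomeomorph k with hΦ₀_def
  set Φ : OpenPartialHomeomorph E' N :=
    Λ.symm.toHomeomorph.toOpenPartialHomeomorph.trans Φ₀ with hΦ
  have hΦcoe : ⇑Φ = k ∘ (Λ.symm : E' → E) := by
    ext u
    simp [hΦ, hΦ₀_def]
  have hΦsrc : Φ.source = univ := by
    simp [hΦ, hΦ₀_def]
  have hΦc : ContMDiffOn 𝓘(ℝ, E') IN ∞ Φ Φ.source := by
    rw [hΦcoe, hΦsrc]
    exact (hk.contMDiff.comp (Λ.symm : E' →L[ℝ] E).contMDiff).contMDiffOn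
  have hΦsymm : ∀ x ∈ Φ.target, Φ.symm x = Λ (Φ₀.symm x) := fun x _ => by
    simp [hΦ]
  have hΦt : Φ.target ⊆ range k := by
    intro x hx
    have h2 : Φ (Φ.symm x) = x := Φ.right_inv hx
    rw [hΦcoe] at h2
    exact ⟨_, h2⟩
  have hΦc' : ContMDiffOn IN 𝓘(ℝ, E') ∞ Φ.symm Φ.target := by
    have h1 : ContMDiffOn IN 𝓘(ℝ, E') ∞ ((Λ : E → E') ∘ Φ₀.symm) (range k) :=
      (Λ : E →L[ℝ] E').contMDiff.comp_contMDiffOn (contMDiffOn_symm_of_isSmoothEmbedding hk hemb)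
    exact (h1.mono hΦt).congr hΦsymm
  rw [← hΦcoe]
  exact isSmoothEmbedding_of_openPartialHomeomorph Φ hΦsrc hΦc hΦc'
    ((Λ.symm.trans (ContinuousLinearEquiv.ofFinrankEq hdim)) : E' ≃L[ℝ] EN)

/-- **Unoriented disc theorem in `N` for discs parametrised by another model space.** Let `N`
be connected and boundaryless with model `IN` over `EN ≅ E` (a linear isomorphism `Λ₀`,
rescaled inside the proof to operator norm `≤ 1`, `ContinuousLinearEquiv.shrink`), `r` a
linear automorphism of `E` with `det r < 0`, and `k, k' : E → N` discs. Then there is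
`g ∈ Diff(N)` with either `g (k y) = k' y` for `‖y‖ ≤ 1` or `g (k (r y)) = k' y` for `‖y‖ ≤ 1`:
the unoriented disc theorem (`exists_diffeomorph_apply_disc_eq_or_reflect_of_model`) for the
discs `k ∘ Λ⁻¹`, `k' ∘ Λ⁻¹` and the reflection `Λ ∘ r ∘ Λ⁻¹` of `EN`, read on the unit ball of
`E` through `Λ` (Hirsch (1976), Ch. 8 §3, Thm. 3.1; Kosinski (1993), III.(3.6)).
[cite: HirschDT1976, Ch. 8 §3, Thm. 3.1] -/
theorem exists_diffeomorph_apply_disc_eq_or_reflect_of_linearEquiv [ConnectedSpace N]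
    [IN.Boundaryless] (hE : finrank ℝ E ≠ 0) (Λ₀ : E ≃L[ℝ] EN)
    (r : E ≃L[ℝ] E) (hr : LinearMap.det (r.toLinearEquiv : E →ₗ[ℝ] E) < 0) {k k' : E → N}
    (hk : Manifold.IsSmoothEmbedding 𝓘(ℝ, E) IN ∞ k)
    (hk' : Manifold.IsSmoothEmbedding 𝓘(ℝ, E) IN ∞ k') :
    ∃ g : N ≃ₘ⟮IN, IN⟯ N,
      (∀ y : E, ‖y‖ ≤ 1 → g (k y) = k' y) ∨ (∀ y : E, ‖y‖ ≤ 1 → g (k (r y)) = k' y) := by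
  haveI : FiniteDimensional ℝ EN := LinearEquiv.finiteDimensional Λ₀.toLinearEquiv
  have hEN : finrank ℝ EN ≠ 0 := by rw [← Λ₀.toLinearEquiv.finrank_eq]; exact hE
  -- rescale `Λ₀` to operator norm `≤ 1`, so that the unit ball of `E` lands in that of `EN`
  set Λ : E ≃L[ℝ] EN := ContinuousLinearEquiv.shrink Λ₀ with hΛ_def
  have hΛ : ∀ y : E, ‖Λ y‖ ≤ ‖y‖ := fun y => ContinuousLinearEquiv.norm_shrink_le Λ₀ y
  have hdim : finrank ℝ E = finrank ℝ EN := Λ₀.toLinearEquiv.finrank_eq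
  have hK := isSmoothEmbedding_disc_comp_symm hk hdim Λ
  have hK' := isSmoothEmbedding_disc_comp_symm hk' hdim Λ
  -- the conjugated reflection `rN = Λ ∘ r ∘ Λ⁻¹`
  let rN : EN ≃L[ℝ] EN := Λ.symm.trans (r.trans Λ)
  have hrN : LinearMap.det (rN.toLinearEquiv : EN →ₗ[ℝ] EN) < 0 := by
    have : (rN.toLinearEquiv : EN →ₗ[ℝ] EN) =
        (Λ.toLinearEquiv : E →ₗ[ℝ] EN) ∘ₗ (r.toLinearEquiv : E →ₗ[ℝ] E) ∘ₗ
          (Λ.toLinearEquiv.symm : EN →ₗ[ℝ] E) := by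
      ext v; rfl
    rw [this, LinearMap.det_conj]
    exact hr
  obtain ⟨g, hg⟩ := exists_diffeomorph_apply_disc_eq_or_reflect_of_model hEN hK hK' rN hrN
  refine ⟨g, ?_⟩
  rcases hg with hg | hg
  · refine Or.inl fun y hy => ?_
    have h := hg (Λ y) ((hΛ y).trans hy)
    simpa using h
  · refine Or.inr fun y hy => ?_
    have h := hg (Λ y) ((hΛ y).trans hy)
    simpa [rN] using h

/-- **In a connected manifold with a reflection-equivariant disc, any two discs are
equivalent** (the hypothesis `hN` of `nonempty_diffeomorph_of_isConnectedSum_of_discs_equivalent`).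
Let `N` be connected, Hausdorff and boundaryless (model `IN` over `EN ≅ E`, `Λ : E ≃L EN`), `r`
a linear isometry of `E` with `det r < 0`, and `c : E → N` a disc with
`ρ (c y) = c (r y)` for some diffeomorphism `ρ` of `N` ("`N` admits a diffeomorphism reversing a
disc", as `S² × S²` does by a reflection of one factor). Then for any two discs `k, k' : E → N`
there is `g ∈ Diff(N)` with `g (k y) = k' y` for all `‖y‖ ≤ 1`. Proof: by the unoriented disc
theorem every disc `k` has `g₁ ∘ k = c` or `g₁ ∘ k ∘ r = c` on the unit ball; in the second
case `ρ ∘ g₁ ∘ k = c` there (`r` preserves the ball); compose the diffeomorphisms obtained for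
`k` and for `k'` (Kosinski (1993), Ch. VI §1, discussion after Thm. (1.1): the connected sum does
not depend on orientation choices when a summand admits an orientation-reversing
diffeomorphism). [cite: Kosinski1993, Ch. VI §1, Thm (1.1)] -/
theorem discs_equivalent_of_equivariant_disc [ConnectedSpace N] [IN.Boundaryless]
    (hE : finrank ℝ E ≠ 0) (Λ : E ≃L[ℝ] EN) (r : E ≃ₗᵢ[ℝ] E)
    (hr : LinearMap.det (r.toLinearEquiv : E →ₗ[ℝ] E) < 0) {c : E → N}
    (hc : Manifold.IsSmoothEmbedding 𝓘(ℝ, E) IN ∞ c) (ρ : N ≃ₘ⟮IN, IN⟯ N)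
    (hρ : ∀ y : E, ρ (c y) = c (r y)) (k k' : E → N)
    (hk : Manifold.IsSmoothEmbedding 𝓘(ℝ, E) IN ∞ k)
    (hk' : Manifold.IsSmoothEmbedding 𝓘(ℝ, E) IN ∞ k') :
    ∃ g : N ≃ₘ⟮IN, IN⟯ N, ∀ y : E, ‖y‖ ≤ 1 → g (k y) = k' y := by
  have hr' : LinearMap.det ((r.toContinuousLinearEquiv).toLinearEquiv : E →ₗ[ℝ] E) < 0 := hr
  -- every disc is equivalent to `c`
  have key : ∀ k : E → N, Manifold.IsSmoothEmbedding 𝓘(ℝ, E) IN ∞ k →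
      ∃ g : N ≃ₘ⟮IN, IN⟯ N, ∀ y : E, ‖y‖ ≤ 1 → g (k y) = c y := by
    intro k hk
    obtain ⟨g₁, hg₁⟩ := exists_diffeomorph_apply_disc_eq_or_reflect_of_linearEquiv hE Λ
      r.toContinuousLinearEquiv hr' hk hc
    rcases hg₁ with hg₁ | hg₁
    · exact ⟨g₁, hg₁⟩
    · refine ⟨g₁.trans ρ, fun y hy => ?_⟩
      have h1 : ‖r.symm y‖ ≤ 1 := by rw [r.symm.norm_map]; exact hy
      have h2 := hg₁ (r.symm y) h1
      rw [show r.toContinuousLinearEquiv (r.symm y) = y from r.apply_symm_apply y] at h2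
      show ρ (g₁ (k y)) = c y
      rw [h2, hρ, r.apply_symm_apply]
  obtain ⟨g, hg⟩ := key k hk
  obtain ⟨g', hg'⟩ := key k' hk'
  refine ⟨g.trans g'.symm, fun y hy => ?_⟩
  show g'.symm (g (k y)) = k' y
  rw [hg y hy, ← hg' y hy, g'.symm_apply_apply]

end Amphichiral

end Literature.Topology.FourManifolds
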